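/- Copyright: the b2b-balaban cell (near-miss cell 7), T⁴-continuum fan-out, row NE7b owner lineage
`b2b-balaban-t4-ne7b-p1` (gen 23), node U5c COUNT member.  Released under the licence of the surrounding project. -/
import Summits.QuantumFields.BalabanUV.T4Continuum.Support.HistoryRealiseCellsRunApex
import Literature.MathematicalPhysics.QuantumFieldTheory.Balaban1983to89.T4ContinuumYM4Torus

/-!
# Realised histories: THE HEADLINE FROM THE COUNT ROAD — `ContinuumYM4Torus D` for block-averaged `SU(N)` data, given (B),
`BetaPertHyp` and the count-road witnesses

Summits-side support leaf of the T⁴-continuum cell (rung (B)+1 on a FINITE torus only; NOT infinite volume, NOT the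
mass gap, NOT the Clay statement; NOT a proof of the spine estimate NE7b).  Row S12 ∕ node A12-I of the claim table
`t4/b2b-balaban-t4-ne7b-p1/LEAVES-NE7b.md` (owner sub-row S12g «APEX», file 3).

WHAT.  `HistoryRealiseCellsRunApex.hybridNE7Under_of_countRoad` (file 2) composed with the apex lineage's
`T4ApexHybrid.targets_of_hybridNE7Under` (for (0.4)-block-averaged data on `SU(N)` with a measurable small-loop average)
and `T4ContinuumYM4Torus.continuumYM4Torus_of_targets`: **`targets_of_countRoad`** (the four T⁴ targets — existence of the
`ε → 0` limit of every joint expectation of unit-scale averaged loop variables, uniqueness of the limit points, reflection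
positivity on the positive-time class, torus covariance) and **`continuumYM4Torus_of_countRoad`** — THE HEADLINE PREDICATE
`ContinuumYM4Torus D` from the two pins `hB : B16.EndStatementBPrinted D.C`, `hβ : BetaPertHyp D.βfun` and the displayed
hypothesis «every tuned run and every loop string carry a `CountRoadWitness`» (+ the datum's sign conventions and the
constants' side conditions).

HONEST READING (verbatim for headlines).  This is the cell's honest dependency chain made kernel-explicit THROUGH ROW NE7b's
END, not a discharge of anything: `ContinuumYM4Torus D ⇐ (B) ∧ BetaPertHyp ∧ [∀ tuned run ∀ string: CountRoadWitness]`, and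
the witness DISPLAYS — as hypothesis shapes, none in print, none a theorem of the tree — H3 (the terms of Bałaban's expansion
read as realised pedigrees with domains, realised costs, the printed price sentence, the numerator readings), the E1∕E2
representation, the (γ) floors ∕ site budgets ∕ envelopes of the (B) side, NE7c's `ShellWeightBound`, NE7's `ReindexedBudget`
(carrying node U4′'s sizes and the recent-scale rates, hence the content of NE1′–NE5, NE9) and four summable rates.  Spine
count 0∕9 UNCHANGED.  [folklore] composition by name; no `def`, no `[cite:]` tag, nothing printed asserted.  HONEST
DEPENDENCY (cell): continuum YM on T⁴ ⇐ BetaPertH ∧ nine spine estimates (0/9 proved); BetaPertH ⇐ (D1) ∧ (D4) ∧ CAP+tail;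
G-an2-4 gates asym, D1 and NE2/3/4.  This file changes none of it. -/

open Literature.MathematicalPhysics.QuantumFieldTheory.Balaban1983to89
open T4Continuum T4PrintedShapeBanking T4CanonicalMenus
open Summit.QuantumFields.BalabanUV.T4Continuum.CountThresholdUniform
open Summit.QuantumFields.BalabanUV.T4Continuum.HistoryConstants
open Summit.QuantumFields.BalabanUV.T4Continuum.HistoryRealiseCellsRunApex

namespace Summit.QuantumFields.BalabanUV.T4Continuum.HistoryRealiseCellsRunHeadline

section SU

variable {F : T4Family} {N : ℕ} [NeZero N] {ℰ : LoopAverage (Matrix.specialUnitaryGroup (Fin N) ℂ)}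

/-- **THE FOUR T⁴ TARGETS FROM THE COUNT ROAD**, for (0.4)-block-averaged data on `SU(N)` with a measurable small-loop
average: `hybridNE7Under_of_countRoad` ∘ `T4ApexHybrid.targets_of_hybridNE7Under`.  CONDITIONAL on (B), `BetaPertHyp`
(inside the targets' own prefix) and the displayed count-road witnesses; NE7b NOT proved. [folklore] -/
theorem targets_of_countRoad (D : FiniteEpsData F (Matrix.specialUnitaryGroup (Fin N) ℂ)) (hBA : D.IsBlockAveraged ℰ)
    (hE : ℰ.MeasurableE) (hsign : B16.SignConventions D.C)
    {C : T4PrintedShapeBanking.Consts} {O : PrintedO1s} (hD : Dominates C O)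
    {rr : ℕ} {β₀ : ℝ} (h : ThresholdOK C F.L rr β₀) (hμ : 0 < C.μ) (d n : ℕ)
    (hκ₁ : (d : ℝ) * Real.log F.L + 2 * Real.log 2 ≤ C.κ₁) (hE₀ : Real.log (2 + birthMass C) ≤ C.E₀)
    (hβ₀ : 0 < β₀) (hLβ : (F.L : ℝ) * β₀ ≤ 1) (hn₁ : 13 ≤ C.n₁) (hn : 0 < n)
    (hData : ∀ (γ g : ℝ) (g₀ : ℕ → ℝ), 0 < γ → 0 < g → D.Tuned γ g g₀ →
      ∀ os : List (ULoop F), ∃ (ι α π : Type) (_ : DecidableEq ι) (_ : DecidableEq α) (_ : DecidableEq π),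
        Nonempty (CountRoadWitness D C O rr d n g₀ os ι α π)) :
    D.ym4_torus_continuum_limit_exists ∧ D.ym4_torus_continuum_limit_unique ∧
      D.limit_reflectionPositive ∧ D.limit_torusCovariant :=
  T4ApexHybrid.targets_of_hybridNE7Under hBA hE
    (hybridNE7Under_of_countRoad D (hBA.avgMeasurable hE) hsign hD h hμ d n hκ₁ hE₀ hβ₀ hLβ hn₁ hn hData)

/-- **THE HEADLINE PREDICATE FROM THE COUNT ROAD**: `T4ContinuumYM4Torus.ContinuumYM4Torus D` for (0.4)-block-averaged data on
`SU(N)` with a measurable small-loop average, GIVEN the two pins `(B) = B16.EndStatementBPrinted D.C` and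
`BetaPertHyp D.βfun` BY NAME, the datum's sign conventions, the constants' side conditions, and a `CountRoadWitness` for
every tuned run and every loop string (`targets_of_countRoad` ∘ `continuumYM4Torus_of_targets`).  Honest reading in the module
docstring: the located new estimates are INSIDE the witness; nothing of them is discharged; NE7b NOT proved; count 0∕9.
[folklore] -/
theorem continuumYM4Torus_of_countRoad (D : FiniteEpsData F (Matrix.specialUnitaryGroup (Fin N) ℂ))
    (hBA : D.IsBlockAveraged ℰ) (hE : ℰ.MeasurableE)
    (hB : B16.EndStatementBPrinted D.C) (hβ : BetaPertHyp D.βfun) (hsign : B16.SignConventions D.C)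
    {C : T4PrintedShapeBanking.Consts} {O : PrintedO1s} (hD : Dominates C O)
    {rr : ℕ} {β₀ : ℝ} (h : ThresholdOK C F.L rr β₀) (hμ : 0 < C.μ) (d n : ℕ)
    (hκ₁ : (d : ℝ) * Real.log F.L + 2 * Real.log 2 ≤ C.κ₁) (hE₀ : Real.log (2 + birthMass C) ≤ C.E₀)
    (hβ₀ : 0 < β₀) (hLβ : (F.L : ℝ) * β₀ ≤ 1) (hn₁ : 13 ≤ C.n₁) (hn : 0 < n)
    (hData : ∀ (γ g : ℝ) (g₀ : ℕ → ℝ), 0 < γ → 0 < g → D.Tuned γ g g₀ →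
      ∀ os : List (ULoop F), ∃ (ι α π : Type) (_ : DecidableEq ι) (_ : DecidableEq α) (_ : DecidableEq π),
        Nonempty (CountRoadWitness D C O rr d n g₀ os ι α π)) :
    T4ContinuumYM4Torus.ContinuumYM4Torus D :=
  T4ContinuumYM4Torus.continuumYM4Torus_of_targets hB hβ
    (targets_of_countRoad D hBA hE hsign hD h hμ d n hκ₁ hE₀ hβ₀ hLβ hn₁ hn hData)

end SU


/-! ## v1.1 (append-only) — THE SAME CHAIN OVER THE SMALL-COUPLING PREFIX (finding F-leaf01g4-1)

The displayed witness hypothesis of `hybridNE7Under_of_countRoad` ∕ `targets_of_countRoad` ∕ `continuumYM4Torus_of_countRoad`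
ranges over EVERY `γ, g > 0` (every positive-coupling tuned run).  The theorems below take it UNDER THE PREFIX
`T4ContinuumYM4Torus.ForSmallCouplings` — «for all SMALL-coupling tuned runs and all loop strings, a count-road witness» — and
merge its thresholds with the pinned END's by `min` (as `ForSmallCouplings.and`).  The v1 statements are their corollaries
(`forSmallCouplings_witness_of_forall`).  Nothing else changes; nothing is discharged; NE7b NOT proved; count 0∕9. -/

section Fsc

variable {F : T4Family} {G : Type*} [GaugeGroup G] [MeasurableSpace G] [HaarData G] [RegularGaugeGroup G]

/-- **file 2's apex input FROM THE PREFIXED WITNESS HYPOTHESIS**: `HybridNE7Under D (BetaPertHyp D.βfun)` ⇐ sign conventions ∧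
constants' side conditions ∧ `ForSmallCouplings D (g₀ ↦ ∀ os, a CountRoadWitness)`; thresholds `min γ₁ γ₂`, `min g₁ g₂`.
CONDITIONAL; NE7b NOT proved. [folklore] -/
theorem hybridNE7Under_of_countRoad_fsc (D : FiniteEpsData F G) (hM : D.AvgMeasurable)
    (hsign : B16.SignConventions D.C)
    {C : T4PrintedShapeBanking.Consts} {O : PrintedO1s} (hD : Dominates C O)
    {rr : ℕ} {β₀ : ℝ} (h : ThresholdOK C F.L rr β₀) (hμ : 0 < C.μ) (d n : ℕ)
    (hκ₁ : (d : ℝ) * Real.log F.L + 2 * Real.log 2 ≤ C.κ₁) (hE₀ : Real.log (2 + birthMass C) ≤ C.E₀)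
    (hβ₀ : 0 < β₀) (hLβ : (F.L : ℝ) * β₀ ≤ 1) (hn₁ : 13 ≤ C.n₁) (hn : 0 < n)
    (hData : T4ContinuumYM4Torus.ForSmallCouplings D fun g₀ => ∀ os : List (ULoop F),
        ∃ (ι α π : Type) (_ : DecidableEq ι) (_ : DecidableEq α) (_ : DecidableEq π),
          Nonempty (CountRoadWitness D C O rr d n g₀ os ι α π)) :
    T4ApexHybrid.HybridNE7Under D (BetaPertHyp D.βfun) := by
  intro hB hβ
  obtain ⟨γ₁, hγ₁, H⟩ := HistoryRealiseCellsRunPinned.hybridNE7_of_realisedDomainsRun_pinned D hB hβ hsign hD h hμ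
    d n hκ₁ hE₀ hβ₀ hLβ hn₁ hn
  obtain ⟨γ₂, hγ₂, H₂⟩ := hData
  refine ⟨min γ₁ γ₂, lt_min hγ₁ hγ₂, fun γ hγ hγle => ?_⟩
  obtain ⟨g₁, hg₁, Hg⟩ := H γ hγ (hγle.trans (min_le_left _ _))
  obtain ⟨g₂, hg₂, Hg₂⟩ := H₂ γ hγ (hγle.trans (min_le_right _ _))
  refine ⟨min g₁ g₂, lt_min hg₁ hg₂, fun g hg hgle g₀ ht os => ?_⟩
  obtain ⟨Em, -, HE⟩ := Hg g hg (hgle.trans (min_le_left _ _))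
  obtain ⟨ι, α, π, _, _, _, ⟨X⟩⟩ := Hg₂ g hg (hgle.trans (min_le_right _ _)) g₀ ht os
  have hm : ∀ K o, Measurable ((D.scheme g₀).obs K o) := fun K o => D.measurable_avgObs hM K o
  have h1 : ∀ K o U, |(D.scheme g₀).obs K o U| ≤ 1 := fun K o U => D.abs_avgObs_le_one K o U
  obtain ⟨K₁, K₂, hK₁, hH⟩ := HE g₀ ht X.l₀ X.vol X.K₀ X.T X.A X.A' X.shA X.shB X.dead X.dead' X.nup X.mup X.Nup
    X.Cc X.Rr X.CcRec X.RrRec X.ν X.u X.s₂ X.q₀ X.r X.s X.Wsh (fun K => T4GenFunBounds.prodObs (D.scheme g₀) K os) 1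
    (fun K => T4GenFunBounds.measurable_prodObs (D.scheme g₀) hm K os)
    (fun K U => T4GenFunBounds.abs_prodObs_le_one (D.scheme g₀) h1 K os U)
    (fun K t ht hK => (X.reprA K t ht hK).le) (fun K t ht hK => (X.reprB K t ht hK).le) X.c₀ X.n₁ X.c₀_pos X.floor
    X.floor' X.sites X.sites' X.Nup_nonneg X.nup_bd X.mup_bd X.R X.isRj X.one_le_R X.ped X.cellP X.liveC X.Zd X.realised
    X.κ X.κ' X.cost_le X.cost_le' X.Fc X.Rf X.Fc' X.Rf' X.price X.price' X.up X.dead_nonneg X.resum X.F_nonneg X.up'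
    X.dead'_nonneg X.resum' X.F'_nonneg X.shell X.budget X.sum_r X.sum_u X.sum_s X.sum_s₂
  exact ⟨X.l₀, X.vol, K₁ + K₂, X.l₀_pos, X.vol_pos, stringHybridNE7_of_hybridNE7 D X hK₁ hH⟩

omit [RegularGaugeGroup G] in
/-- The v1 hypothesis (every `γ, g > 0`) implies the prefixed one (thresholds `1, 1`): the v1 theorems are corollaries of the
`_fsc` ones. [folklore] -/
theorem forSmallCouplings_witness_of_forall (D : FiniteEpsData F G) {C : T4PrintedShapeBanking.Consts} {O : PrintedO1s}
    {rr d n : ℕ}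
    (hData : ∀ (γ g : ℝ) (g₀ : ℕ → ℝ), 0 < γ → 0 < g → D.Tuned γ g g₀ → ∀ os : List (ULoop F),
        ∃ (ι α π : Type) (_ : DecidableEq ι) (_ : DecidableEq α) (_ : DecidableEq π),
          Nonempty (CountRoadWitness D C O rr d n g₀ os ι α π)) :
    T4ContinuumYM4Torus.ForSmallCouplings D fun g₀ => ∀ os : List (ULoop F),
        ∃ (ι α π : Type) (_ : DecidableEq ι) (_ : DecidableEq α) (_ : DecidableEq π),
          Nonempty (CountRoadWitness D C O rr d n g₀ os ι α π) :=
  ⟨1, one_pos, fun γ hγ _ => ⟨1, one_pos, fun g hg _ g₀ ht => hData γ g g₀ hγ hg ht⟩⟩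

end Fsc

section SUFsc

variable {F : T4Family} {N : ℕ} [NeZero N] {ℰ : LoopAverage (Matrix.specialUnitaryGroup (Fin N) ℂ)}

/-- **THE FOUR T⁴ TARGETS FROM THE COUNT ROAD, PREFIXED WITNESS HYPOTHESIS** (v1.1). CONDITIONAL; NE7b NOT proved. [folklore] -/
theorem targets_of_countRoad_fsc (D : FiniteEpsData F (Matrix.specialUnitaryGroup (Fin N) ℂ)) (hBA : D.IsBlockAveraged ℰ)
    (hE : ℰ.MeasurableE) (hsign : B16.SignConventions D.C)
    {C : T4PrintedShapeBanking.Consts} {O : PrintedO1s} (hD : Dominates C O)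
    {rr : ℕ} {β₀ : ℝ} (h : ThresholdOK C F.L rr β₀) (hμ : 0 < C.μ) (d n : ℕ)
    (hκ₁ : (d : ℝ) * Real.log F.L + 2 * Real.log 2 ≤ C.κ₁) (hE₀ : Real.log (2 + birthMass C) ≤ C.E₀)
    (hβ₀ : 0 < β₀) (hLβ : (F.L : ℝ) * β₀ ≤ 1) (hn₁ : 13 ≤ C.n₁) (hn : 0 < n)
    (hData : T4ContinuumYM4Torus.ForSmallCouplings D fun g₀ => ∀ os : List (ULoop F),
        ∃ (ι α π : Type) (_ : DecidableEq ι) (_ : DecidableEq α) (_ : DecidableEq π),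
          Nonempty (CountRoadWitness D C O rr d n g₀ os ι α π)) :
    D.ym4_torus_continuum_limit_exists ∧ D.ym4_torus_continuum_limit_unique ∧
      D.limit_reflectionPositive ∧ D.limit_torusCovariant :=
  T4ApexHybrid.targets_of_hybridNE7Under hBA hE
    (hybridNE7Under_of_countRoad_fsc D (hBA.avgMeasurable hE) hsign hD h hμ d n hκ₁ hE₀ hβ₀ hLβ hn₁ hn hData)

/-- **THE HEADLINE PREDICATE FROM THE COUNT ROAD, PREFIXED WITNESS HYPOTHESIS** (v1.1): `ContinuumYM4Torus D` (itself
`ForSmallCouplings`-prefixed) ⇐ (B) ∧ `BetaPertHyp` ∧ [for all SMALL-coupling tuned runs and all loop strings, a count-road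
witness] (+ sign conventions, constants' side conditions).  Honest reading as in the module docstring with «∀ tuned run» read
under the prefix; nothing discharged; NE7b NOT proved; count 0∕9. [folklore] -/
theorem continuumYM4Torus_of_countRoad_fsc (D : FiniteEpsData F (Matrix.specialUnitaryGroup (Fin N) ℂ))
    (hBA : D.IsBlockAveraged ℰ) (hE : ℰ.MeasurableE)
    (hB : B16.EndStatementBPrinted D.C) (hβ : BetaPertHyp D.βfun) (hsign : B16.SignConventions D.C)
    {C : T4PrintedShapeBanking.Consts} {O : PrintedO1s} (hD : Dominates C O)
    {rr : ℕ} {β₀ : ℝ} (h : ThresholdOK C F.L rr β₀) (hμ : 0 < C.μ) (d n : ℕ)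
    (hκ₁ : (d : ℝ) * Real.log F.L + 2 * Real.log 2 ≤ C.κ₁) (hE₀ : Real.log (2 + birthMass C) ≤ C.E₀)
    (hβ₀ : 0 < β₀) (hLβ : (F.L : ℝ) * β₀ ≤ 1) (hn₁ : 13 ≤ C.n₁) (hn : 0 < n)
    (hData : T4ContinuumYM4Torus.ForSmallCouplings D fun g₀ => ∀ os : List (ULoop F),
        ∃ (ι α π : Type) (_ : DecidableEq ι) (_ : DecidableEq α) (_ : DecidableEq π),
          Nonempty (CountRoadWitness D C O rr d n g₀ os ι α π)) :
    T4ContinuumYM4Torus.ContinuumYM4Torus D :=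
  T4ContinuumYM4Torus.continuumYM4Torus_of_targets hB hβ
    (targets_of_countRoad_fsc D hBA hE hsign hD h hμ d n hκ₁ hE₀ hβ₀ hLβ hn₁ hn hData)

end SUFsc

end Summit.QuantumFields.BalabanUV.T4Continuum.HistoryRealiseCellsRunHeadline
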